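import Mathlib.Analysis.Calculus.MeanValue
import Literature.Analysis.FluidPDE.CompressibleEulerLinearizedUniqueness
import Literature.Analysis.FluidPDE.CompressibleEulerSymmetricForm
import HarnessLib

/-!
# Uniqueness of classical solutions of the Euler system of a monatomic fluid on `𝕋³`

Analysis/FluidPDE support file (everything proved), layer L6 of the programme to discharge
`Literature.Analysis.FluidPDE.CompressibleEulerLocalWellPosedness` (Majda 1984, Ch. 2,
Thms 2.1–2.2): the uniqueness clause of Majda's Thm 2.1 / Dafermos' Thm 5.1.1 for CLASSICAL
solutions of the complete Euler system of a monatomic fluid with the athermal law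
`p = ρϑζ(ρ)`, `e = 3ϑ/2` (`EulerEOS.monatomicExcess ζ f`) on the flat torus, in the region
`ρ < ρ̄` where `(ρζ)' > 0` (hyperbolicity / positive symmetriser):

* `IsPrimitiveEulerSolutionOn.unique_Icc_monatomicExcess` — two primitive solutions on
  `[0, τ] × 𝕋³` with the same data at `t = 0`, the first with density `< ρ̄`, coincide;
* `IsClassicalEulerSolution.unique_monatomicExcess` — the same for classical (conservative)
  solutions on `[0, T₁)`, `[0, T₂)`: they agree on `[0, min T₁ T₂)`.

Proof: the differences `(ρ₁ - ρ₂, u₁ - u₂, ϑ₁ - ϑ₂)` solve the linearised symmetric system at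
the first solution with zeroth-order residuals (`CompressibleEulerSymmetricForm.lean`,
`continuity_sub` / `euler_sub` / `temperature_sub`), whose coefficients are bounded on the compact
`[0, τ] × 𝕋³` (uniform bounds of smooth fields, and Lipschitz bounds of `ζ` and of
`k(ρ) = (ρζ)'(ρ)/ρ` on the compact range of the densities by the mean value theorem); the
weights `ϑ₁(ρζ)'(ρ₁)/ρ₁`, `ρ₁`, `3ρ₁/(2ϑ₁)` of the energy are bounded below by a positive
constant; `linearized_vanishing` (`CompressibleEulerLinearizedUniqueness.lean`) concludes.
This is Dafermos 2005, (5.1.18)–(5.1.23) with `V = V̄ = U`, i.e. Thm 5.2.1 restricted to classical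
solutions, and the uniqueness part of Majda 1984, Thm 2.1.

## References

* A. Majda, *Compressible Fluid Flow and Systems of Conservation Laws in Several Space
  Variables*, Appl. Math. Sci. 53, Springer 1984, Ch. 2 §2.1, Thm 2.1 (uniqueness of the
  classical solution). [`Majda1984`]
* C. M. Dafermos, *Hyperbolic Conservation Laws in Continuum Physics*, 2nd ed. (2005), §5.1,
  (5.1.18)–(5.1.23); §5.2, Thm 5.2.1. [`Dafermos2005`]
-/

noncomputable section

open Set Function Filter MeasureTheory
open scoped ContDiff _root_.Topology InnerProductSpace

namespace Literature.Analysis.FluidPDE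

namespace CompressibleEuler

open Literature.Analysis.FunctionSpaces

/-! ## Uniform bounds on a compact slab -/

section Bounds

variable {d : Type*} [Fintype d] {F : Type*} [NormedAddCommGroup F] [NormedSpace ℝ F]
  {t₀ t₁ : ℝ}

/-- A jointly smooth field on `[t₀, t₁] × 𝕋^d` is bounded by a NONNEGATIVE constant. [folklore] -/
theorem exists_nonneg_norm_le {φ : ℝ → UnitAddTorus d → F}
    (hφ : FunctionSpaces.Torus.IsSmoothSpaceTimeOn (Icc t₀ t₁) φ) :
    ∃ C : ℝ, 0 ≤ C ∧ ∀ s ∈ Icc t₀ t₁, ∀ x, ‖φ s x‖ ≤ C := by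
  obtain ⟨C, hC⟩ := hφ.exists_norm_le_of_isCompact isCompact_Icc subset_rfl
  exact ⟨max C 0, le_max_right _ _, fun s hs x => (hC s hs x).trans (le_max_left _ _)⟩

/-- A POSITIVE jointly smooth scalar field on `[t₀, t₁] × 𝕋^d` is bounded below by a positive
constant (its reciprocal is a jointly smooth field, hence bounded). [folklore] -/
theorem exists_pos_le {φ : ℝ → UnitAddTorus d → ℝ}
    (hφ : FunctionSpaces.Torus.IsSmoothSpaceTimeOn (Icc t₀ t₁) φ)
    (hpos : ∀ s ∈ Icc t₀ t₁, ∀ x, 0 < φ s x) :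
    ∃ δ : ℝ, 0 < δ ∧ ∀ s ∈ Icc t₀ t₁, ∀ x, δ ≤ φ s x := by
  have hinv : FunctionSpaces.Torus.IsSmoothSpaceTimeOn (Icc t₀ t₁) (fun s x => (φ s x)⁻¹) := by
    refine ContDiffOn.inv hφ ?_
    rintro ⟨s, y⟩ hz
    exact (hpos s hz.1 _).ne'
  obtain ⟨C, hC⟩ := hinv.exists_norm_le_of_isCompact isCompact_Icc subset_rfl
  refine ⟨(max C 1)⁻¹, by positivity, fun s hs x => ?_⟩
  have h1 : (φ s x)⁻¹ ≤ max C 1 := by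
    have := hC s hs x
    rw [Real.norm_eq_abs, abs_of_pos (inv_pos.2 (hpos s hs x))] at this
    exact this.trans (le_max_left _ _)
  exact (inv_le_comm₀ (by positivity) (hpos s hs x)).2 h1

/-- **Lipschitz bound on a compact interval by the mean value theorem.** A function smooth on an
open set `U ⊆ ℝ` is Lipschitz on every compact interval `[lo, hi] ⊆ U`, with a nonnegative
constant. [folklore] -/
theorem exists_lipschitz_on_Icc {φ : ℝ → ℝ} {U : Set ℝ} (hU : IsOpen U) (hφ : ContDiffOn ℝ ∞ φ U)
    {lo hi : ℝ} (hJ : Icc lo hi ⊆ U) :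
    ∃ L : ℝ, 0 ≤ L ∧ ∀ x ∈ Icc lo hi, ∀ y ∈ Icc lo hi, |φ x - φ y| ≤ L * |x - y| := by
  have hcont : ContinuousOn (deriv φ) (Icc lo hi) :=
    (hφ.continuousOn_deriv_of_isOpen hU (by simp)).mono hJ
  obtain ⟨C, hC⟩ := isCompact_Icc.exists_bound_of_continuousOn hcont
  refine ⟨max C 0, le_max_right _ _, fun x hx y hy => ?_⟩
  have hdiff : ∀ z ∈ Icc lo hi, DifferentiableAt ℝ φ z := fun z hz =>
    (hφ.differentiableOn (by simp) z (hJ hz)).differentiableAt (hU.mem_nhds (hJ hz))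
  have h := Convex.norm_image_sub_le_of_norm_deriv_le (C := max C 0) hdiff
    (fun z hz => (hC z hz).trans (le_max_left C 0)) (convex_Icc lo hi) hy hx
  rw [Real.norm_eq_abs, Real.norm_eq_abs] at h
  exact h

/-- `‖∑ᵢ wᵢ • mᵢ‖ ≤ (∑ᵢ ‖mᵢ‖) ‖w‖` for `w ∈ ℝ^d`. [folklore] -/
theorem norm_sum_coord_smul_le (w : EuclideanSpace ℝ d) (m : d → F) :
    ‖∑ i, w i • m i‖ ≤ (∑ i, ‖m i‖) * ‖w‖ := by
  calc ‖∑ i, w i • m i‖ ≤ ∑ i, ‖w i • m i‖ := norm_sum_le _ _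
    _ = ∑ i, |w i| * ‖m i‖ := by simp_rw [norm_smul, Real.norm_eq_abs]
    _ ≤ ∑ i, ‖w‖ * ‖m i‖ := by
        refine Finset.sum_le_sum fun i _ => ?_
        have hi : |w i| ≤ ‖w‖ := by
          have := PiLp.norm_apply_le w i
          rwa [Real.norm_eq_abs] at this
        exact mul_le_mul_of_nonneg_right hi (norm_nonneg _)
    _ = (∑ i, ‖m i‖) * ‖w‖ := by rw [Finset.sum_mul]; simp_rw [mul_comm]

/-- Scalar bookkeeping: `|θ k + ϑ Δ| ≤ (C_k + C_ϑ L)(|r| + |θ|)` when `|k| ≤ C_k`, `|ϑ| ≤ C_ϑ`,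
`|Δ| ≤ L|r|`. [folklore] -/
theorem abs_mul_add_mul_le {θ k ϑ Δ Ck Cϑ L r : ℝ} (hk : |k| ≤ Ck) (hϑ : |ϑ| ≤ Cϑ)
    (hΔ : |Δ| ≤ L * |r|) (hCk : 0 ≤ Ck) (hCϑ : 0 ≤ Cϑ) (hL : 0 ≤ L) :
    |θ * k + ϑ * Δ| ≤ (Ck + Cϑ * L) * (|r| + |θ|) := by
  have h1 : |θ * k| ≤ |θ| * Ck := by rw [abs_mul]; exact mul_le_mul_of_nonneg_left hk (abs_nonneg _)
  have h2 : |ϑ * Δ| ≤ Cϑ * (L * |r|) := by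
    rw [abs_mul]; exact mul_le_mul hϑ hΔ (abs_nonneg _) hCϑ
  have h3 := abs_add_le (θ * k) (ϑ * Δ)
  nlinarith [abs_nonneg r, abs_nonneg θ, mul_nonneg hCk (abs_nonneg r),
    mul_nonneg (mul_nonneg hCϑ hL) (abs_nonneg θ)]

/-- Scalar bookkeeping: `c₁ n_w + c₂ (n_r + n_θ) ≤ L (n_r + n_w + n_θ)` when `c₁ + c₂ ≤ L` and
everything is nonnegative. [folklore] -/
theorem mul_add_mul_le_mul_sum {c₁ c₂ L nr nw nθ : ℝ} (hr : 0 ≤ nr) (hw : 0 ≤ nw) (hθ : 0 ≤ nθ)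
    (hc₁ : 0 ≤ c₁) (hc₂ : 0 ≤ c₂) (hL : c₁ + c₂ ≤ L) :
    c₁ * nw + c₂ * (nr + nθ) ≤ L * (nr + nw + nθ) := by
  nlinarith [mul_nonneg hc₁ hr, mul_nonneg hc₁ hθ, mul_nonneg hc₂ hw]

end Bounds

/-! ## Uniqueness on a closed time interval -/

section Unique

variable {ζ f : ℝ → ℝ} {τ ρm : ℝ} {ρ₁ ρ₂ : ℝ → UnitAddTorus (Fin 3) → ℝ}
  {u₁ u₂ : ℝ → UnitAddTorus (Fin 3) → EuclideanSpace ℝ (Fin 3)} {ϑ₁ ϑ₂ : ℝ → UnitAddTorus (Fin 3) → ℝ}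

/-- **Uniqueness of primitive solutions on `[0, τ]`** for the monatomic athermal law
`p = ρϑζ(ρ)`, `e = 3ϑ/2` with `ζ` smooth and `(ρζ)' > 0` on `(0, ρ̄)`: two primitive solutions on
`[0, τ] × 𝕋³` (`τ > 0`) with the same data at `t = 0`, the first one with density `< ρ̄`,
coincide on `[0, τ]` (energy method for the linearised symmetric system solved by the
difference, `linearized_vanishing`; Majda 1984, Thm 2.1; Dafermos 2005, Thms 5.1.1/5.2.1).
[cite: Majda1984, Ch. 2 §2.1 Thm 2.1] -/
theorem IsPrimitiveEulerSolutionOn.unique_Icc_monatomicExcess (hτ : 0 < τ) (hζ : ContDiff ℝ ∞ ζ)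
    (hζ' : ∀ r ∈ Ioo 0 ρm, 0 < deriv (fun s : ℝ => s * ζ s) r)
    (h₁ : IsPrimitiveEulerSolutionOn (EulerEOS.monatomicExcess ζ f) (Icc 0 τ) ρ₁ u₁ ϑ₁)
    (h₂ : IsPrimitiveEulerSolutionOn (EulerEOS.monatomicExcess ζ f) (Icc 0 τ) ρ₂ u₂ ϑ₂)
    (hρm : ∀ t ∈ Icc 0 τ, ∀ x, ρ₁ t x < ρm)
    (h0ρ : ρ₁ 0 = ρ₂ 0) (h0u : u₁ 0 = u₂ 0) (h0ϑ : ϑ₁ 0 = ϑ₂ 0) :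
    ∀ t ∈ Icc 0 τ, ρ₁ t = ρ₂ t ∧ u₁ t = u₂ t ∧ ϑ₁ t = ϑ₂ t := by
  classical
  have hU : UniqueDiffOn ℝ (Icc 0 τ) := uniqueDiffOn_Icc hτ
  set dh : ℝ → ℝ := deriv (fun s : ℝ => s * ζ s) with hdh
  have hdhs : ContDiff ℝ ∞ dh := contDiff_deriv_mul_zeta hζ
  -- the fields of the linearised system
  set r : ℝ → UnitAddTorus (Fin 3) → ℝ := fun s y => ρ₁ s y - ρ₂ s y with hr
  set w : ℝ → UnitAddTorus (Fin 3) → EuclideanSpace ℝ (Fin 3) := fun s y => u₁ s y - u₂ s y with hw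
  set θ : ℝ → UnitAddTorus (Fin 3) → ℝ := fun s y => ϑ₁ s y - ϑ₂ s y with hθ
  set a : ℝ → UnitAddTorus (Fin 3) → ℝ := fun s y => ϑ₁ s y * dh (ρ₁ s y) / ρ₁ s y with ha
  set b : ℝ → UnitAddTorus (Fin 3) → ℝ := fun s y => ζ (ρ₁ s y) with hb
  set g : ℝ → UnitAddTorus (Fin 3) → ℝ := fun s y => 2 / 3 * (ϑ₁ s y * ζ (ρ₁ s y)) with hg
  set d₃ : ℝ → UnitAddTorus (Fin 3) → ℝ := fun s y => 3 * ρ₁ s y / (2 * ϑ₁ s y) with hd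
  -- smoothness
  have sρ₁ := h₁.smooth_density
  have sρ₂ := h₂.smooth_density
  have su₁ := h₁.smooth_velocity
  have su₂ := h₂.smooth_velocity
  have sϑ₁ := h₁.smooth_temperature
  have sϑ₂ := h₂.smooth_temperature
  have pρ₁ := h₁.density_pos
  have pρ₂ := h₂.density_pos
  have pϑ₁ := h₁.temperature_pos
  have pϑ₂ := h₂.temperature_pos
  have sr : FunctionSpaces.Torus.IsSmoothSpaceTimeOn (Icc 0 τ) r := sρ₁.sub sρ₂
  have sw : FunctionSpaces.Torus.IsSmoothSpaceTimeOn (Icc 0 τ) w := su₁.sub su₂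
  have sθ : FunctionSpaces.Torus.IsSmoothSpaceTimeOn (Icc 0 τ) θ := sϑ₁.sub sϑ₂
  have sdh₁ : FunctionSpaces.Torus.IsSmoothSpaceTimeOn (Icc 0 τ) (fun s y => dh (ρ₁ s y)) :=
    hdhs.comp_contDiffOn sρ₁
  have sdh₂ : FunctionSpaces.Torus.IsSmoothSpaceTimeOn (Icc 0 τ) (fun s y => dh (ρ₂ s y)) :=
    hdhs.comp_contDiffOn sρ₂
  have sζ₁ : FunctionSpaces.Torus.IsSmoothSpaceTimeOn (Icc 0 τ) (fun s y => ζ (ρ₁ s y)) :=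
    hζ.comp_contDiffOn sρ₁
  have sζ₂ : FunctionSpaces.Torus.IsSmoothSpaceTimeOn (Icc 0 τ) (fun s y => ζ (ρ₂ s y)) :=
    hζ.comp_contDiffOn sρ₂
  have hρ₁ne : ∀ z ∈ Icc 0 τ ×ˢ (univ : Set (EuclideanSpace ℝ (Fin 3))),
      FunctionSpaces.Torus.stLift ρ₁ z ≠ 0 := fun z hz => (pρ₁ z.1 hz.1 _).ne'
  have hρ₂ne : ∀ z ∈ Icc 0 τ ×ˢ (univ : Set (EuclideanSpace ℝ (Fin 3))),
      FunctionSpaces.Torus.stLift ρ₂ z ≠ 0 := fun z hz => (pρ₂ z.1 hz.1 _).ne'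
  have hϑ₁ne : ∀ z ∈ Icc 0 τ ×ˢ (univ : Set (EuclideanSpace ℝ (Fin 3))),
      2 * FunctionSpaces.Torus.stLift ϑ₁ z ≠ 0 := fun z hz => by
    have := (pϑ₁ z.1 hz.1 (FunctionSpaces.Torus.proj z.2)).ne'
    simpa [FunctionSpaces.Torus.stLift] using this
  have sa : FunctionSpaces.Torus.IsSmoothSpaceTimeOn (Icc 0 τ) a := (sϑ₁.mul sdh₁).div sρ₁ hρ₁ne
  -- the same coefficient along the second solution, and `k = h'/ρ`
  have sa₂ : FunctionSpaces.Torus.IsSmoothSpaceTimeOn (Icc 0 τ)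
      (fun s y => ϑ₂ s y * dh (ρ₂ s y) / ρ₂ s y) := (sϑ₂.mul sdh₂).div sρ₂ hρ₂ne
  have sk₁ : FunctionSpaces.Torus.IsSmoothSpaceTimeOn (Icc 0 τ) (fun s y => dh (ρ₁ s y) / ρ₁ s y) :=
    sdh₁.div sρ₁ hρ₁ne
  have sb : FunctionSpaces.Torus.IsSmoothSpaceTimeOn (Icc 0 τ) b := sζ₁
  have sg : FunctionSpaces.Torus.IsSmoothSpaceTimeOn (Icc 0 τ) g := (sϑ₁.mul sζ₁).const_smul (2 / 3 : ℝ)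
  have sd : FunctionSpaces.Torus.IsSmoothSpaceTimeOn (Icc 0 τ) d₃ :=
    (sρ₁.const_smul (3 : ℝ)).div (sϑ₁.const_smul (2 : ℝ)) hϑ₁ne
  -- compatibility of the weights: `d₃ g = ρ₁ ζ(ρ₁) = c b`
  have hm : ∀ s ∈ Icc 0 τ, ∀ x, d₃ s x * g s x = ρ₁ s x * b s x := fun s hs x => by
    simp only [hd, hg, hb]
    field_simp [(pϑ₁ s hs x).ne']
  -- positivity of the weights
  have pa : ∀ s ∈ Icc 0 τ, ∀ x, 0 < a s x := fun s hs x => by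
    simp only [ha]
    exact div_pos (mul_pos (pϑ₁ s hs x) (hζ' _ ⟨pρ₁ s hs x, hρm s hs x⟩)) (pρ₁ s hs x)
  have pd : ∀ s ∈ Icc 0 τ, ∀ x, 0 < d₃ s x := fun s hs x => by
    simp only [hd]
    exact div_pos (mul_pos three_pos (pρ₁ s hs x)) (mul_pos two_pos (pϑ₁ s hs x))
  obtain ⟨δa, hδa0, hδa⟩ := exists_pos_le sa pa
  obtain ⟨δc, hδc0, hδc⟩ := exists_pos_le sρ₁ pρ₁
  obtain ⟨δd, hδd0, hδd⟩ := exists_pos_le sd pd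
  set δ := min δa (min δc δd) with hδ
  have hδ0 : 0 < δ := lt_min hδa0 (lt_min hδc0 hδd0)
  have hδ1 : ∀ s ∈ Icc 0 τ, ∀ x, δ ≤ a s x := fun s hs x => (min_le_left _ _).trans (hδa s hs x)
  have hδ2 : ∀ s ∈ Icc 0 τ, ∀ x, δ ≤ ρ₁ s x := fun s hs x =>
    ((min_le_right _ _).trans (min_le_left _ _)).trans (hδc s hs x)
  have hδ3 : ∀ s ∈ Icc 0 τ, ∀ x, δ ≤ d₃ s x := fun s hs x =>
    ((min_le_right _ _).trans (min_le_right _ _)).trans (hδd s hs x)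
  -- the compact range `[lo, hi] ⊆ (0, ∞)` of both densities
  obtain ⟨δ₂, hδ₂0, hδ₂⟩ := exists_pos_le sρ₂ pρ₂
  obtain ⟨Cρ₁, -, hCρ₁⟩ := exists_nonneg_norm_le sρ₁
  obtain ⟨Cρ₂, -, hCρ₂⟩ := exists_nonneg_norm_le sρ₂
  set lo := min δc δ₂ with hlo
  set hi := max Cρ₁ Cρ₂ with hhi
  have hlo0 : 0 < lo := lt_min hδc0 hδ₂0
  have hJ : Icc lo hi ⊆ Ioi 0 := fun z hz => hlo0.trans_le hz.1
  have mem₁ : ∀ s ∈ Icc 0 τ, ∀ x, ρ₁ s x ∈ Icc lo hi := fun s hs x =>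
    ⟨(min_le_left _ _).trans (hδc s hs x), by
      have := hCρ₁ s hs x
      rw [Real.norm_eq_abs] at this
      exact ((le_abs_self _).trans this).trans (le_max_left _ _)⟩
  have mem₂ : ∀ s ∈ Icc 0 τ, ∀ x, ρ₂ s x ∈ Icc lo hi := fun s hs x =>
    ⟨(min_le_right _ _).trans (hδ₂ s hs x), by
      have := hCρ₂ s hs x
      rw [Real.norm_eq_abs] at this
      exact ((le_abs_self _).trans this).trans (le_max_right _ _)⟩
  -- Lipschitz bounds of `ζ` and of `k = h'/ρ` on `[lo, hi]`
  obtain ⟨Lζ, hLζ0, hLζ⟩ := exists_lipschitz_on_Icc isOpen_univ hζ.contDiffOn (subset_univ (Icc lo hi))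
  have hk : ContDiffOn ℝ ∞ (fun ρ : ℝ => dh ρ / ρ) (Ioi 0) :=
    hdhs.contDiffOn.div contDiffOn_id fun z hz => (ne_of_gt hz)
  obtain ⟨Lk, hLk0, hLk⟩ := exists_lipschitz_on_Icc isOpen_Ioi hk hJ
  -- uniform bounds of all coefficient fields entering the residuals
  obtain ⟨Ck₁, hCk₁0, hCk₁⟩ := exists_nonneg_norm_le sk₁
  obtain ⟨Cζ₁, hCζ₁0, hCζ₁⟩ := exists_nonneg_norm_le sζ₁
  obtain ⟨Cϑ₂, hCϑ₂0, hCϑ₂⟩ := exists_nonneg_norm_le sϑ₂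
  obtain ⟨Cdiv, hCdiv0, hCdiv⟩ := exists_nonneg_norm_le (su₂.divergence hU)
  obtain ⟨CGρ, hCGρ0, hCGρ⟩ := exists_nonneg_norm_le (sρ₂.gradient hU)
  obtain ⟨CGϑ, hCGϑ0, hCGϑ⟩ := exists_nonneg_norm_le (sϑ₂.gradient hU)
  have hPρ : ∀ i : Fin 3, ∃ C : ℝ, 0 ≤ C ∧ ∀ s ∈ Icc 0 τ, ∀ x,
      ‖FunctionSpaces.Torus.partialDeriv i (ρ₂ s) x‖ ≤ C := fun i => exists_nonneg_norm_le (sρ₂.partialDeriv hU i)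
  choose Cpρ hCpρ0 hCpρ using hPρ
  have hPϑ : ∀ i : Fin 3, ∃ C : ℝ, 0 ≤ C ∧ ∀ s ∈ Icc 0 τ, ∀ x,
      ‖FunctionSpaces.Torus.partialDeriv i (ϑ₂ s) x‖ ≤ C := fun i => exists_nonneg_norm_le (sϑ₂.partialDeriv hU i)
  choose Cpϑ hCpϑ0 hCpϑ using hPϑ
  have hPu : ∀ i : Fin 3, ∃ C : ℝ, 0 ≤ C ∧ ∀ s ∈ Icc 0 τ, ∀ x,
      ‖FunctionSpaces.Torus.partialDeriv i (u₂ s) x‖ ≤ C := fun i => exists_nonneg_norm_le (su₂.partialDeriv hU i)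
  choose Cpu hCpu0 hCpu using hPu
  have hSρ : 0 ≤ ∑ i, Cpρ i := Finset.sum_nonneg fun i _ => hCpρ0 i
  have hSϑ : 0 ≤ ∑ i, Cpϑ i := Finset.sum_nonneg fun i _ => hCpϑ0 i
  have hSu : 0 ≤ ∑ i, Cpu i := Finset.sum_nonneg fun i _ => hCpu0 i
  -- one Lipschitz-type constant for the three residuals
  set L : ℝ := (∑ i, Cpρ i) + Cdiv + (∑ i, Cpu i) + (Ck₁ + Cϑ₂ * Lk) * CGρ + Lζ * CGϑ +
    (∑ i, Cpϑ i) + (Cζ₁ + Cϑ₂ * Lζ) * Cdiv with hLdef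
  have hL0 : 0 ≤ L := by rw [hLdef]; positivity
  -- the residual bounds
  have hR : ∀ s ∈ Icc 0 τ, ∀ x,
      |FunctionSpaces.Torus.timeDerivWithin (Icc 0 τ) r s x +
          (∑ i, u₁ s x i * FunctionSpaces.Torus.partialDeriv i (r s) x) +
          ρ₁ s x * FunctionSpaces.Torus.divergence (w s) x| ≤ L * (|r s x| + ‖w s x‖ + |θ s x|) ∧
      ‖FunctionSpaces.Torus.timeDerivWithin (Icc 0 τ) w s x +
          (∑ i, u₁ s x i • FunctionSpaces.Torus.partialDeriv i (w s) x) +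
          a s x • FunctionSpaces.Torus.gradient (r s) x +
          b s x • FunctionSpaces.Torus.gradient (θ s) x‖ ≤ L * (|r s x| + ‖w s x‖ + |θ s x|) ∧
      |FunctionSpaces.Torus.timeDerivWithin (Icc 0 τ) θ s x +
          (∑ i, u₁ s x i * FunctionSpaces.Torus.partialDeriv i (θ s) x) +
          g s x * FunctionSpaces.Torus.divergence (w s) x| ≤ L * (|r s x| + ‖w s x‖ + |θ s x|) := by
    intro s hs x
    have nr : 0 ≤ |r s x| := abs_nonneg _
    have nw : 0 ≤ ‖w s x‖ := norm_nonneg _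
    have nθ : 0 ≤ |θ s x| := abs_nonneg _
    -- the differences of the nonlinear coefficients are Lipschitz in `(r, θ)`
    have hkdiff : |dh (ρ₁ s x) / ρ₁ s x - dh (ρ₂ s x) / ρ₂ s x| ≤ Lk * |r s x| :=
      hLk _ (mem₁ s hs x) _ (mem₂ s hs x)
    have hζdiff : |ζ (ρ₁ s x) - ζ (ρ₂ s x)| ≤ Lζ * |r s x| := hLζ _ (mem₁ s hs x) _ (mem₂ s hs x)
    have hk₁ : |dh (ρ₁ s x) / ρ₁ s x| ≤ Ck₁ := by
      have := hCk₁ s hs x; rwa [Real.norm_eq_abs] at this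
    have hζ₁ : |ζ (ρ₁ s x)| ≤ Cζ₁ := by
      have := hCζ₁ s hs x; rwa [Real.norm_eq_abs] at this
    have hϑ₂b : |ϑ₂ s x| ≤ Cϑ₂ := by
      have := hCϑ₂ s hs x; rwa [Real.norm_eq_abs] at this
    have hadiff : |a s x - ϑ₂ s x * dh (ρ₂ s x) / ρ₂ s x| ≤ (Ck₁ + Cϑ₂ * Lk) * (|r s x| + |θ s x|) := by
      have e : a s x - ϑ₂ s x * dh (ρ₂ s x) / ρ₂ s x =
          θ s x * (dh (ρ₁ s x) / ρ₁ s x) + ϑ₂ s x * (dh (ρ₁ s x) / ρ₁ s x - dh (ρ₂ s x) / ρ₂ s x) := by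
        simp only [ha, hθ]; ring
      rw [e]
      exact abs_mul_add_mul_le hk₁ hϑ₂b hkdiff hCk₁0 hCϑ₂0 hLk0
    have hgdiff : |g s x - 2 / 3 * (ϑ₂ s x * ζ (ρ₂ s x))| ≤ (Cζ₁ + Cϑ₂ * Lζ) * (|r s x| + |θ s x|) := by
      have e : g s x - 2 / 3 * (ϑ₂ s x * ζ (ρ₂ s x)) =
          2 / 3 * (θ s x * ζ (ρ₁ s x) + ϑ₂ s x * (ζ (ρ₁ s x) - ζ (ρ₂ s x))) := by
        simp only [hg, hθ]; ring
      rw [e, abs_mul, abs_of_pos (by norm_num : (0 : ℝ) < 2 / 3)]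
      have h1 := abs_mul_add_mul_le (θ := θ s x) hζ₁ hϑ₂b hζdiff hCζ₁0 hCϑ₂0 hLζ0
      have h2 : 0 ≤ (Cζ₁ + Cϑ₂ * Lζ) * (|r s x| + |θ s x|) := by positivity
      linarith
    -- pointwise bounds of the derivatives of the second solution
    have bdiv : |FunctionSpaces.Torus.divergence (u₂ s) x| ≤ Cdiv := by
      have := hCdiv s hs x; rwa [Real.norm_eq_abs] at this
    have bGρ : ‖FunctionSpaces.Torus.gradient (ρ₂ s) x‖ ≤ CGρ := hCGρ s hs x
    have bGϑ : ‖FunctionSpaces.Torus.gradient (ϑ₂ s) x‖ ≤ CGϑ := hCGϑ s hs x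
    have bSρ : |∑ i, w s x i * FunctionSpaces.Torus.partialDeriv i (ρ₂ s) x| ≤ (∑ i, Cpρ i) * ‖w s x‖ :=
      (abs_sum_coord_mul_le _ _).trans (mul_le_mul_of_nonneg_right
        (Finset.sum_le_sum fun i _ => by have := hCpρ i s hs x; rwa [Real.norm_eq_abs] at this) nw)
    have bSϑ : |∑ i, w s x i * FunctionSpaces.Torus.partialDeriv i (ϑ₂ s) x| ≤ (∑ i, Cpϑ i) * ‖w s x‖ :=
      (abs_sum_coord_mul_le _ _).trans (mul_le_mul_of_nonneg_right
        (Finset.sum_le_sum fun i _ => by have := hCpϑ i s hs x; rwa [Real.norm_eq_abs] at this) nw)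
    have bSu : ‖∑ i, w s x i • FunctionSpaces.Torus.partialDeriv i (u₂ s) x‖ ≤ (∑ i, Cpu i) * ‖w s x‖ :=
      (norm_sum_coord_smul_le _ _).trans (mul_le_mul_of_nonneg_right
        (Finset.sum_le_sum fun i _ => hCpu i s hs x) nw)
    -- constants appearing in `L` are nonnegative
    have qa : 0 ≤ (Ck₁ + Cϑ₂ * Lk) * CGρ := by positivity
    have qb : 0 ≤ Lζ * CGϑ := by positivity
    have qc : 0 ≤ (Cζ₁ + Cϑ₂ * Lζ) * Cdiv := by positivity
    have hrr : ρ₁ s x - ρ₂ s x = r s x := rfl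
    have hw' : ∀ i, u₁ s x i - u₂ s x i = w s x i := fun i => by simp [hw]
    refine ⟨?_, ?_, ?_⟩
    · -- continuity residual
      rw [h₁.continuity_sub h₂ hU hs x, abs_neg]
      simp_rw [hw', hrr]
      have h1 : |(∑ i, w s x i * FunctionSpaces.Torus.partialDeriv i (ρ₂ s) x) +
            r s x * FunctionSpaces.Torus.divergence (u₂ s) x| ≤
          (∑ i, Cpρ i) * ‖w s x‖ + Cdiv * (|r s x| + |θ s x|) := by
        refine (abs_add_le _ _).trans (add_le_add bSρ ?_)
        rw [abs_mul]
        calc |r s x| * |FunctionSpaces.Torus.divergence (u₂ s) x| ≤ |r s x| * Cdiv :=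
              mul_le_mul_of_nonneg_left bdiv nr
          _ = Cdiv * |r s x| := mul_comm _ _
          _ ≤ Cdiv * (|r s x| + |θ s x|) := mul_le_mul_of_nonneg_left (by linarith) hCdiv0
      refine h1.trans (mul_add_mul_le_mul_sum nr nw nθ hSρ hCdiv0 ?_)
      rw [hLdef]; linarith
    · -- Euler residual
      rw [h₁.euler_sub hζ h₂ hU hs x, norm_neg]
      simp_rw [hw']
      have h1 : ‖(∑ i, w s x i • FunctionSpaces.Torus.partialDeriv i (u₂ s) x) +
            (a s x - ϑ₂ s x * dh (ρ₂ s x) / ρ₂ s x) • FunctionSpaces.Torus.gradient (ρ₂ s) x +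
            (ζ (ρ₁ s x) - ζ (ρ₂ s x)) • FunctionSpaces.Torus.gradient (ϑ₂ s) x‖ ≤
          (∑ i, Cpu i) * ‖w s x‖ + ((Ck₁ + Cϑ₂ * Lk) * CGρ + Lζ * CGϑ) * (|r s x| + |θ s x|) := by
        refine norm_add₃_le.trans ?_
        rw [norm_smul, norm_smul, Real.norm_eq_abs, Real.norm_eq_abs, add_mul, add_assoc]
        refine add_le_add bSu (add_le_add ?_ ?_)
        · calc |a s x - ϑ₂ s x * dh (ρ₂ s x) / ρ₂ s x| * ‖FunctionSpaces.Torus.gradient (ρ₂ s) x‖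
              ≤ (Ck₁ + Cϑ₂ * Lk) * (|r s x| + |θ s x|) * CGρ :=
                mul_le_mul hadiff bGρ (norm_nonneg _) (by positivity)
            _ = (Ck₁ + Cϑ₂ * Lk) * CGρ * (|r s x| + |θ s x|) := by ring
        · calc |ζ (ρ₁ s x) - ζ (ρ₂ s x)| * ‖FunctionSpaces.Torus.gradient (ϑ₂ s) x‖
              ≤ Lζ * |r s x| * CGϑ := mul_le_mul hζdiff bGϑ (norm_nonneg _) (by positivity)
            _ = Lζ * CGϑ * |r s x| := by ring
            _ ≤ Lζ * CGϑ * (|r s x| + |θ s x|) := mul_le_mul_of_nonneg_left (by linarith) qb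
      refine h1.trans (mul_add_mul_le_mul_sum nr nw nθ hSu (add_nonneg qa qb) ?_)
      rw [hLdef]; linarith
    · -- temperature residual
      rw [h₁.temperature_sub h₂ hU hs x, abs_neg]
      simp_rw [hw']
      have h1 : |(∑ i, w s x i * FunctionSpaces.Torus.partialDeriv i (ϑ₂ s) x) +
            (g s x - 2 / 3 * (ϑ₂ s x * ζ (ρ₂ s x))) * FunctionSpaces.Torus.divergence (u₂ s) x| ≤
          (∑ i, Cpϑ i) * ‖w s x‖ + (Cζ₁ + Cϑ₂ * Lζ) * Cdiv * (|r s x| + |θ s x|) := by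
        refine (abs_add_le _ _).trans (add_le_add bSϑ ?_)
        rw [abs_mul]
        calc |g s x - 2 / 3 * (ϑ₂ s x * ζ (ρ₂ s x))| * |FunctionSpaces.Torus.divergence (u₂ s) x|
            ≤ (Cζ₁ + Cϑ₂ * Lζ) * (|r s x| + |θ s x|) * Cdiv :=
              mul_le_mul hgdiff bdiv (abs_nonneg _) (by positivity)
          _ = (Cζ₁ + Cϑ₂ * Lζ) * Cdiv * (|r s x| + |θ s x|) := by ring
      refine h1.trans (mul_add_mul_le_mul_sum nr nw nθ hSϑ qc ?_)
      rw [hLdef]; linarith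
  -- zero data and conclusion
  have h0r : r 0 = 0 := by funext y; simp [hr, h0ρ]
  have h0w : w 0 = 0 := by funext y; simp [hw, h0u]
  have h0θ : θ 0 = 0 := by funext y; simp [hθ, h0ϑ]
  have hvan := linearized_vanishing (b := b) hτ sr sθ sw su₁ sa sρ₁ sg sd hm hδ0 hδ1 hδ2 hδ3 hL0 hR
    h0r h0w h0θ
  intro t ht
  obtain ⟨e1, e2, e3⟩ := hvan t ht
  refine ⟨?_, ?_, ?_⟩
  · funext y; have := congrFun e1 y; simp only [hr, Pi.zero_apply, sub_eq_zero] at this; exact this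
  · funext y; have := congrFun e2 y; simp only [hw, Pi.zero_apply, sub_eq_zero] at this; exact this
  · funext y; have := congrFun e3 y; simp only [hθ, Pi.zero_apply, sub_eq_zero] at this; exact this

end Unique

/-! ## Uniqueness of classical solutions on `[0, T)` -/

section Classical

variable {ζ f : ℝ → ℝ} {T₁ T₂ ρm : ℝ} {ρ₁ ρ₂ : ℝ → UnitAddTorus (Fin 3) → ℝ}
  {u₁ u₂ : ℝ → UnitAddTorus (Fin 3) → EuclideanSpace ℝ (Fin 3)} {ϑ₁ ϑ₂ : ℝ → UnitAddTorus (Fin 3) → ℝ}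

/-- **Uniqueness of classical solutions of the Euler system of a monatomic fluid on `𝕋³`**
(Majda 1984, Thm 2.1, uniqueness clause; Dafermos 2005, Thms 5.1.1/5.2.1): for the athermal law
`p = ρϑζ(ρ)`, `e = 3ϑ/2` with `ζ` smooth and `(ρζ)' > 0` on `(0, ρ̄)`, two classical solutions on
`[0, T₁)`, `[0, T₂)` with the same initial data, the first with density `< ρ̄`, coincide on
`[0, min T₁ T₂)` (restrict both to `[0, t]`, pass to the primitive form, and apply
`IsPrimitiveEulerSolutionOn.unique_Icc_monatomicExcess`). [cite: Majda1984, Ch. 2 §2.1 Thm 2.1] -/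
theorem IsClassicalEulerSolution.unique_monatomicExcess (hζ : ContDiff ℝ ∞ ζ)
    (hζ' : ∀ r ∈ Ioo 0 ρm, 0 < deriv (fun s : ℝ => s * ζ s) r)
    (h₁ : IsClassicalEulerSolution (EulerEOS.monatomicExcess ζ f) T₁ ρ₁ u₁ ϑ₁)
    (h₂ : IsClassicalEulerSolution (EulerEOS.monatomicExcess ζ f) T₂ ρ₂ u₂ ϑ₂)
    (hρm : ∀ t ∈ Ico 0 T₁, ∀ x, ρ₁ t x < ρm)
    (h0ρ : ρ₁ 0 = ρ₂ 0) (h0u : u₁ 0 = u₂ 0) (h0ϑ : ϑ₁ 0 = ϑ₂ 0) :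
    ∀ t ∈ Ico 0 (min T₁ T₂), ρ₁ t = ρ₂ t ∧ u₁ t = u₂ t ∧ ϑ₁ t = ϑ₂ t := by
  intro t ht
  obtain ⟨ht0, htT⟩ := ht
  rcases ht0.eq_or_lt with rfl | htpos
  · exact ⟨h0ρ, h0u, h0ϑ⟩
  have hp : ContDiffOn ℝ ∞ (uncurry (EulerEOS.monatomicExcess ζ f).p) (Ioi 0 ×ˢ Ioi 0) :=
    (contDiff_monatomicExcess_p hζ).contDiffOn
  have he : ContDiffOn ℝ ∞ (uncurry (EulerEOS.monatomicExcess ζ f).e) (Ioi 0 ×ˢ Ioi 0) :=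
    contDiff_monatomicExcess_e.contDiffOn
  have hsub₁ : Icc 0 t ⊆ Ico 0 T₁ := fun s hs => ⟨hs.1, hs.2.trans_lt (htT.trans_le (min_le_left _ _))⟩
  have hsub₂ : Icc 0 t ⊆ Ico 0 T₂ := fun s hs => ⟨hs.1, hs.2.trans_lt (htT.trans_le (min_le_right _ _))⟩
  have hU : UniqueDiffOn ℝ (Icc 0 t) := uniqueDiffOn_Icc htpos
  have k₁ := ((isClassicalEulerSolutionOn_Ico_iff.2 h₁).mono he hsub₁ hU).primitive hU hp he
  have k₂ := ((isClassicalEulerSolutionOn_Ico_iff.2 h₂).mono he hsub₂ hU).primitive hU hp he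
  exact k₁.unique_Icc_monatomicExcess htpos hζ hζ' k₂ (fun s hs x => hρm s (hsub₁ hs) x) h0ρ h0u h0ϑ t
    ⟨ht0, le_rfl⟩

end Classical

end CompressibleEuler

end Literature.Analysis.FluidPDE

end
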